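import Mathlib
import HarnessLib
import Literature.MathematicalPhysics.KineticTheory.VelocityFlipNoise
import Summits.AtomisticToContinuum.FouriersLaw.Theorems.VanishingNoiseTransferVanishingNoiseBoundNoisyKuboLink
import Summits.AtomisticToContinuum.FouriersLaw.Theorems.OddSectorIrreversibilityResponseDensityGibbsCutoff

/-!
# The Lebesgue transpose of the flip-noisy generator on functions of the energy (dual Kubo road, part 1/3)

`--supports stmt-AtomisticToContinuum-11976` helper file (crux `VanishingNoiseBound`, route
`VanishingNoiseTransfer`, line `fekete-usc-one-length`, stub S3' `stub_flipForwardFieldRegularity`, wave 4).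

Part 1 of the DUAL Kubo link of the velocity-flip chain (parts 2/3: `…FlipDualKuboIdentity`, `…FlipDualKuboLink`),
which removes every derivative bound from the forward-field hypothesis `FF(ε)` of the landed reduction
`noisyPositiveConductance_of_flipForwardFields` by testing the `δ`-dependent forward field of `L_δ + εS` against the
EXPLICIT Gibbs density (the device of route `OddSectorIrreversibility/ResponseDensity`). Elementary pointwise facts:

* `dualTest_comp_hamiltonian` — the Lebesgue transpose `ᵀ(L_{T_L,T_R} + εS) = −L_{T_L,T_R} + 2γ(T_L ∂²_{p_0} +
  T_R ∂²_{p_{L−1}}) + 2γ + εS` evaluated on a function of the energy `F∘H` (`L ≥ 2`):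
  `γ Σ_b (T_b F''(H) p_b² + T_b F'(H) + F'(H) p_b² + F(H))` — the flips and the Liouville field do not see `F∘H`
  (`generator_comp_hamiltonian`, `partialP_partialP_comp_hamiltonian`, `H ∘ F_i = H`).
* `sum_ite_baths`, `abs_bathBracket_le`, `sq_momentum_add_one_le`, `integrable_of_abs_le_exp_neg`,
  `two_div_lt_inv_max` — bookkeeping used by the dominated-convergence argument of part 2 and the link of part 3.
* `helper_flipDualTranspose` — registered helper (notation-free restatement of `dualTest_comp_hamiltonian`).

References: Bonetto–Lebowitz–Rey-Bellet 2000 §4.1 eq. (10); Cuneo–Eckmann–Hairer–Rey-Bellet 2018 §3 eq. (3.3);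
Bernardin–Olla 2011 §2.1.
-/

noncomputable section

open MeasureTheory Filter Topology Set ProbabilityTheory
open scoped ContDiff NNReal ENNReal
open Literature.MathematicalPhysics.KineticTheory.HeatConduction
open Literature.MathematicalPhysics.KineticTheory Literature.Probability.Process OscillatorChain
open Summit.AtomisticToContinuum.FouriersLaw.Theorems
open Summit.AtomisticToContinuum.FouriersLaw.Theorems.SubdiffusiveBondHeat (abs_sq_momentum_sub_le_exp integrable_of_abs_le_exp)
open Summit.AtomisticToContinuum.FouriersLaw.Cruxes.SuperadditiveResistance.FloatingProbeBypassLaplacian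
  (pinnedChain_memLp_two_snd pinnedChain_integral_snd_sq)
open Summit.AtomisticToContinuum.FouriersLaw.Theorems.SuperadditiveResistance.DeviceLiouville (kin kin_eq_sq)
open Summit.AtomisticToContinuum.FouriersLaw.Cruxes.ConductanceLowerBound.ForecastSensitivity (memLp_two_of_abs_le_exp)

namespace Summit.AtomisticToContinuum.FouriersLaw.Theorems.VanishingNoiseBound

/-! ## Elementary sums over the two baths -/

/-- The bath sum of the generator for `L ≥ 2`: only the sites `0` and `L − 1` contribute. -/
theorem sum_ite_baths {L : ℕ} (hL2 : 2 ≤ L) (a b : Fin L → ℝ) :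
    (∑ i : Fin L, ((if i.val = 0 then a i else 0) + (if i.val = L - 1 then b i else 0))) =
      a ⟨0, by omega⟩ + b ⟨L - 1, by omega⟩ := by
  rw [Finset.sum_add_distrib]
  congr 1
  · rw [Finset.sum_eq_single ⟨0, by omega⟩]
    · simp
    · intro i _ hi
      have : i.val ≠ 0 := fun h => hi (Fin.ext h)
      simp [this]
    · intro h; exact absurd (Finset.mem_univ _) h
  · rw [Finset.sum_eq_single ⟨L - 1, by omega⟩]
    · simp
    · intro i _ hi
      have : i.val ≠ L - 1 := fun h => hi (Fin.ext h)
      simp [this]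
    · intro h; exact absurd (Finset.mem_univ _) h

/-! ## The transposed flip generator on functions of the energy -/

section Transpose

variable {ω₂ lam β γ : ℝ}

/-- **The transposed flip generator on `F∘H`.** For `L ≥ 2` and `F` twice differentiable,
`−L_{T_L,T_R}(F∘H) + 2γ(T_L ∂²_{p_0}(F∘H) + T_R ∂²_{p_{L−1}}(F∘H)) + 2γ F∘H + εS(F∘H)
 = γ((T_L F''(H) p_0² + T_L F'(H) + F'(H) p_0² + F(H)) + (T_R F''(H) p_{L−1}² + T_R F'(H) + F'(H) p_{L−1}² + F(H)))`
(`generator_comp_hamiltonian`, `partialP_partialP_comp_hamiltonian`, `S(F∘H) = 0`). -/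
theorem dualTest_comp_hamiltonian {L : ℕ} (hL2 : 2 ≤ L) (T_L T_R ε : ℝ) {F F' F'' : ℝ → ℝ}
    (hF : ∀ v, HasDerivAt F (F' v) v) (hF' : ∀ v, HasDerivAt F' (F'' v) v) (x : PhaseSpace L) :
    -((pinnedChain ω₂ lam β γ).generator L T_L T_R (fun y => F ((pinnedChain ω₂ lam β γ).hamiltonian L y)) x) +
        2 * γ * (T_L * partialP (⟨0, by omega⟩ : Fin L) (partialP (⟨0, by omega⟩ : Fin L)
            (fun y => F ((pinnedChain ω₂ lam β γ).hamiltonian L y))) x +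
          T_R * partialP (⟨L - 1, by omega⟩ : Fin L) (partialP (⟨L - 1, by omega⟩ : Fin L)
            (fun y => F ((pinnedChain ω₂ lam β γ).hamiltonian L y))) x) +
        2 * γ * F ((pinnedChain ω₂ lam β γ).hamiltonian L x) +
        ε * flipNoise L (fun y => F ((pinnedChain ω₂ lam β γ).hamiltonian L y)) x =
      γ * ((T_L * (F'' ((pinnedChain ω₂ lam β γ).hamiltonian L x) * x.2 ⟨0, by omega⟩ ^ 2 +
              F' ((pinnedChain ω₂ lam β γ).hamiltonian L x)) +
            F' ((pinnedChain ω₂ lam β γ).hamiltonian L x) * x.2 ⟨0, by omega⟩ ^ 2 +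
            F ((pinnedChain ω₂ lam β γ).hamiltonian L x)) +
          (T_R * (F'' ((pinnedChain ω₂ lam β γ).hamiltonian L x) * x.2 ⟨L - 1, by omega⟩ ^ 2 +
              F' ((pinnedChain ω₂ lam β γ).hamiltonian L x)) +
            F' ((pinnedChain ω₂ lam β γ).hamiltonian L x) * x.2 ⟨L - 1, by omega⟩ ^ 2 +
            F ((pinnedChain ω₂ lam β γ).hamiltonian L x))) := by
  set P := pinnedChain ω₂ lam β γ with hP
  have hHd : Differentiable ℝ (P.hamiltonian L) :=
    (pinnedChain_contDiff_hamiltonian ω₂ lam β γ L (n := 1)).differentiable one_ne_zero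
  have hγ' : P.γ = γ := rfl
  have hgen := P.generator_comp_hamiltonian hHd hF hF' T_L T_R x
  rw [sum_ite_baths hL2] at hgen
  have hS : flipNoise L (fun y => F (P.hamiltonian L y)) x = 0 := by
    rw [flipNoise_eq]
    exact Finset.sum_eq_zero fun i _ => by rw [P.hamiltonian_momentumFlip i x, sub_self]
  rw [hgen, hS, P.partialP_partialP_comp_hamiltonian hF hF' L x ⟨0, by omega⟩,
    P.partialP_partialP_comp_hamiltonian hF hF' L x ⟨L - 1, by omega⟩, hγ']
  ring

end Transpose

/-! ## The exact dual response identity -/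

section Dual

variable {ω₂ lam β γ : ℝ}

/-- Integrability on phase space of a measurable function dominated by `K e^{-cH}`, `c > 0`. -/
theorem integrable_of_abs_le_exp_neg (hω : 0 < ω₂) (hl : 0 ≤ lam) (hβ : 0 ≤ β) (γ : ℝ) {L : ℕ}
    {f : PhaseSpace L → ℝ} (hf : AEStronglyMeasurable f volume) {K c : ℝ} (hc : 0 < c)
    (hfb : ∀ x, |f x| ≤ K * Real.exp (-(c * (pinnedChain ω₂ lam β γ).hamiltonian L x))) :
    Integrable f volume := by
  refine Integrable.mono' ((pinnedChain_integrable_exp_neg_mul_hamiltonian hω hl hβ γ L hc).const_mul K) hf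
    (Eventually.of_forall fun x => ?_)
  rw [Real.norm_eq_abs]
  exact hfb x

/-- `p_i² + 1 ≤ (2/η + 1) e^{ηH}` (`η > 0`). -/
theorem sq_momentum_add_one_le (hω : 0 < ω₂) (hl : 0 ≤ lam) (hβ : 0 ≤ β) (γ : ℝ) {L : ℕ} {η : ℝ} (hη : 0 < η)
    (x : PhaseSpace L) (i : Fin L) :
    x.2 i ^ 2 + 1 ≤ (2 / η + 1) * Real.exp (η * (pinnedChain ω₂ lam β γ).hamiltonian L x) := by
  have h1 := abs_sq_momentum_sub_le_exp (γ := γ) hω hl hβ hη le_rfl x i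
  rw [sub_zero, add_zero] at h1
  have h2 : 1 ≤ Real.exp (η * (pinnedChain ω₂ lam β γ).hamiltonian L x) :=
    Real.one_le_exp (mul_nonneg hη.le (pinnedChain_hamiltonian_nonneg hω.le hl hβ γ L x))
  have h3 : x.2 i ^ 2 ≤ 2 / η * Real.exp (η * (pinnedChain ω₂ lam β γ).hamiltonian L x) :=
    (le_abs_self _).trans h1
  nlinarith

/-- The elementary bound behind the domination: if `|f|, |f'|, |f''| ≤ A e` (`A, e ≥ 0`) then
`|t (f'' p² + f') + f' p² + f| ≤ A e (|t| + 1) (p² + 1)`. -/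
theorem abs_bathBracket_le {t f f' f'' p e A : ℝ} (hf : |f| ≤ A * e)
    (hf' : |f'| ≤ A * e) (hf'' : |f''| ≤ A * e) :
    |t * (f'' * p ^ 2 + f') + f' * p ^ 2 + f| ≤ A * e * (|t| + 1) * (p ^ 2 + 1) := by
  have hp : 0 ≤ p ^ 2 := sq_nonneg p
  have h1 : |t * (f'' * p ^ 2 + f')| ≤ |t| * (A * e * p ^ 2 + A * e) := by
    rw [abs_mul]
    refine mul_le_mul_of_nonneg_left ?_ (abs_nonneg _)
    calc |f'' * p ^ 2 + f'| ≤ |f'' * p ^ 2| + |f'| := abs_add_le _ _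
      _ = |f''| * p ^ 2 + |f'| := by rw [abs_mul, abs_of_nonneg hp]
      _ ≤ A * e * p ^ 2 + A * e := add_le_add (mul_le_mul_of_nonneg_right hf'' hp) hf'
  have h2 : |f' * p ^ 2| ≤ A * e * p ^ 2 := by
    rw [abs_mul, abs_of_nonneg hp]; exact mul_le_mul_of_nonneg_right hf' hp
  calc |t * (f'' * p ^ 2 + f') + f' * p ^ 2 + f|
      ≤ |t * (f'' * p ^ 2 + f') + f' * p ^ 2| + |f| := abs_add_le _ _
    _ ≤ (|t * (f'' * p ^ 2 + f')| + |f' * p ^ 2|) + |f| := by gcongr; exact abs_add_le _ _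
    _ ≤ (|t| * (A * e * p ^ 2 + A * e) + A * e * p ^ 2) + A * e := add_le_add (add_le_add h1 h2) hf
    _ = A * e * (|t| + 1) * (p ^ 2 + 1) := by ring

end Dual

/-! ## An elementary temperature bound -/

/-- `max(T + δ/2, T − δ/2) < 3T/2` for `|δ| < T`, in the form `2/(3T) < 1/max`. -/
theorem two_div_lt_inv_max {T δ : ℝ} (hT : 0 < T) (hδ : |δ| < T) :
    2 / (3 * T) < 1 / max (T + δ / 2) (T - δ / 2) := by
  have hδ1 := abs_lt.1 hδ
  have hmax : max (T + δ / 2) (T - δ / 2) < 3 * T / 2 := max_lt (by linarith) (by linarith)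
  have hmax0 : 0 < max (T + δ / 2) (T - δ / 2) := lt_max_of_lt_left (by linarith)
  rw [div_lt_div_iff₀ (by positivity) hmax0]; nlinarith

/-! ## Registered helper -/

/-- Registered helper sub-goal `helper_flipDualTranspose` of stub `stub_flipForwardFieldRegularity` (line
`fekete-usc-one-length`, crux stmt-AtomisticToContinuum-11976): the transposed flip generator on functions of the
energy (`dualTest_comp_hamiltonian`). -/
theorem helper_flipDualTranspose : ∀ (ω₂ lam β γ : ℝ) (L : ℕ) (hL2 : 2 ≤ L) (T_L T_R ε : ℝ) (F F' F'' : ℝ → ℝ), (∀ v, HasDerivAt F (F' v) v) → (∀ v, HasDerivAt F' (F'' v) v) → ∀ x : Literature.MathematicalPhysics.KineticTheory.HeatConduction.PhaseSpace L, -((Literature.MathematicalPhysics.KineticTheory.HeatConduction.pinnedChain ω₂ lam β γ).generator L T_L T_R (fun y => F ((Literature.MathematicalPhysics.KineticTheory.HeatConduction.pinnedChain ω₂ lam β γ).hamiltonian L y)) x) + 2 * γ * (T_L * Literature.MathematicalPhysics.KineticTheory.HeatConduction.partialP (⟨0, by omega⟩ : Fin L) (Literature.MathematicalPhysics.KineticTheory.HeatConduction.partialP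 (⟨0, by omega⟩ : Fin L) (fun y => F ((Literature.MathematicalPhysics.KineticTheory.HeatConduction.pinnedChain ω₂ lam β γ).hamiltonian L y))) x + T_R * Literature.MathematicalPhysics.KineticTheory.HeatConduction.partialP (⟨L - 1, by omega⟩ : Fin L) (Literature.MathematicalPhysics.KineticTheory.HeatConduction.partialP (⟨L - 1, by omega⟩ : Fin L) (fun y => F ((Literature.MathematicalPhysics.KineticTheory.HeatConduction.pinnedChain ω₂ lam β γ).hamiltonian L y))) x) + 2 * γ * F ((Literature.MathematicalPhysics.KineticTheory.HeatConduction.pinnedChain ω₂ lam β γ).hamiltonian L x) + ε * Literature.MathematicalPhysics.KineticTheory.HeatConduction.flipNoise L (fun y => F ((Literature.MathematicalPhysics.KineticTheory.HeatConduction.pinnedChain ω₂ lam β γ).hamiltonian L y)) x = γ * ((T_L * (F'' ((Literature.MathematicalPhysics.KineticTheory.HeatConduction.pinnedChain ω₂ lam β γ).hamiltonian L x) * x.2 ⟨0, by omega⟩ ^ 2 + F' ((Literature.MathematicalPhysics.KineticTheory.HeatConduction.pinnedChain ω₂ lam β γ).hamiltonian L x)) + F' ((Literature.MathematicalPhysics.KineticTheory.HeatConduction.pinnedChain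 ω₂ lam β γ).hamiltonian L x) * x.2 ⟨0, by omega⟩ ^ 2 + F ((Literature.MathematicalPhysics.KineticTheory.HeatConduction.pinnedChain ω₂ lam β γ).hamiltonian L x)) + (T_R * (F'' ((Literature.MathematicalPhysics.KineticTheory.HeatConduction.pinnedChain ω₂ lam β γ).hamiltonian L x) * x.2 ⟨L - 1, by omega⟩ ^ 2 + F' ((Literature.MathematicalPhysics.KineticTheory.HeatConduction.pinnedChain ω₂ lam β γ).hamiltonian L x)) + F' ((Literature.MathematicalPhysics.KineticTheory.HeatConduction.pinnedChain ω₂ lam β γ).hamiltonian L x) * x.2 ⟨L - 1, by omega⟩ ^ 2 + F ((Literature.MathematicalPhysics.KineticTheory.HeatConduction.pinnedChain ω₂ lam β γ).hamiltonian L x))) :=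
  fun _ _ _ _ _ hL2 T_L T_R ε _ _ _ hF hF' x => dualTest_comp_hamiltonian hL2 T_L T_R ε hF hF' x

end Summit.AtomisticToContinuum.FouriersLaw.Theorems.VanishingNoiseBound

end
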